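import Literature.AlgebraicGeometry.Resolution.StrictNormalCrossingsLabels
import Literature.AlgebraicGeometry.Resolution.RsopPartOfRegularSequence
import HarnessLib

/-!
# Simple normal crossings from non-zero-divisor data at the points

Topic: `Literature/AlgebraicGeometry/Resolution`. The FIBRE-SIDE criterion for the simple
normal crossings condition `HasSNCWith E C` of `MarkedIdeals.lean` (BGMW 2011, Def. 3.1.1 /
Def. 3.1.3 (2)) used when a resolution is specialized from the generic fibre of a family to
the other fibres (`SpreadsShapedFromGenericPoint`, `CanonicalResolutionSpread.lean`): the
hypotheses are REGULARITY of the local rings of the finite intersections of the divisors (and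
of the centre with the divisors transversal to it) and NON-ZERO-DIVISOR conditions for the
local equations modulo the previous ones — exactly the properties that survive the non-flat
base change to a fibre (smoothness of the corresponding subschemes of the family over the
base, and relative effective Cartier divisors, `BlowupsRelativeCartier.lean`) — with no
dimension counts (`IsRsopPart.of_forall_mem_nonZeroDivisors`,
`exists_isRsopPart_append_span_eq`, `RsopPartOfRegularSequence.lean`; then
`hasSNCWith_of_isRsopPart_labels`, `StrictNormalCrossingsLabels.lean`). Everything is PROVED:

* `isRsopPart_comp_equivFin_symm` — the local equations `f_D`, `D ∈ 𝒜` (a finite set), form a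
  part of a regular system of parameters of the Noetherian local ring `R` as soon as
  `R/(f_D : D ∈ 𝒜)` is regular and each `f_D` is a non-zero-divisor modulo `(f_{D'} : D' ∈ T)`
  for every `T ⊆ 𝒜` not containing `D`;
* `isRsopPart_quotient_comp_equivFin_symm` — the same in `R/J` from data modulo `J + (f_T)`;
* `hasSNCWith_of_nonZeroDivisor_data` — **`HasSNCWith E C` on a locally Noetherian scheme
  from: principal stalks `(f_D)` of the divisors through each point `x`; regularity of
  `𝒪_{X,x}/(f_T)` and the non-zero-divisor property of `f_D` modulo `(f_T)` (`D ∉ T`); and, at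
  points of `V(C)`, regularity of `𝒪_{X,x}/(C_x + (f_T))` and the non-zero-divisor property
  of `f_D` modulo `C_x + (f_T)` for the divisors `D`, `T` whose equations do not lie in `C_x`.**

## Sources

* E. Bierstone, D. Grigoriev, P. Milman, J. Włodarczyk, arXiv:1206.3090, Def. 3.1.1,
  Def. 3.1.3 (2). [BierstoneGrigorievMilmanWlodarczyk2011]
* H. Matsumura, *Commutative Ring Theory* (1986), Thm. 14.2, Thm. 17.4. [Matsumura1987]
-/

noncomputable section

open CategoryTheory AlgebraicGeometry TopologicalSpace IsLocalRing

namespace Literature.AlgebraicGeometry.Resolution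

universe u v

/-! ## Algebra: parts of regular systems of parameters indexed by finite sets -/

section Algebra

variable {R : Type u} [CommRing R]

/-- Non-zero-divisors modulo equal ideals. [folklore] -/
theorem mem_nonZeroDivisors_mk_of_eq {I I' : Ideal R} (h : I = I') {a : R}
    (ha : Ideal.Quotient.mk I a ∈ nonZeroDivisors (R ⧸ I)) :
    Ideal.Quotient.mk I' a ∈ nonZeroDivisors (R ⧸ I') := by
  subst h
  exact ha

/-- Regularity of quotients by equal ideals. [folklore] -/
theorem isRegularLocalRing_quotient_of_eq {I I' : Ideal R} (h : I = I')
    (hI : IsRegularLocalRing (R ⧸ I)) : IsRegularLocalRing (R ⧸ I') := by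
  subst h
  exact hI

variable [IsLocalRing R] [IsNoetherianRing R]

/-- **Local equations indexed by a finite set form a part of a regular system of parameters**
when the total quotient is regular and each equation is a non-zero-divisor modulo any set of
the others (`IsRsopPart.of_forall_mem_nonZeroDivisors` along the enumeration
`Finset.equivFin`). [cite: Matsumura1987, Thm. 14.2 (Remark) and Thm. 17.4] -/
theorem isRsopPart_comp_equivFin_symm {ι₀ : Type v} [DecidableEq ι₀] (𝒜 : Finset ι₀)
    (f : ι₀ → R) (hm : ∀ D ∈ 𝒜, f D ∈ maximalIdeal R)
    (hreg : IsRegularLocalRing (R ⧸ Ideal.span (f '' (𝒜 : Set ι₀))))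
    (hnzd : ∀ T : Finset ι₀, T ⊆ 𝒜 → ∀ D ∈ 𝒜, D ∉ T →
      Ideal.Quotient.mk (Ideal.span (f '' (T : Set ι₀))) (f D) ∈
        nonZeroDivisors (R ⧸ Ideal.span (f '' (T : Set ι₀)))) :
    IsRsopPart (fun k : Fin 𝒜.card => f (𝒜.equivFin.symm k)) := by
  set e := 𝒜.equivFin with he
  set g : Fin 𝒜.card → R := fun k => f (e.symm k) with hg
  have hgm : ∀ k, g k ∈ maximalIdeal R := fun k => hm _ (e.symm k).2
  -- the prefixes of the enumeration
  have hpre : ∀ i : Fin 𝒜.card,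
      ∃ T : Finset ι₀, T ⊆ 𝒜 ∧ ((e.symm i : ι₀) ∉ T) ∧
        f '' (T : Set ι₀) = g '' {j : Fin 𝒜.card | (j : ℕ) < (i : ℕ)} := by
    intro i
    refine ⟨(Finset.univ.filter fun j : Fin 𝒜.card => (j : ℕ) < (i : ℕ)).image
      fun j => ((e.symm j : 𝒜) : ι₀), ?_, ?_, ?_⟩
    · intro D hD
      obtain ⟨j, -, rfl⟩ := Finset.mem_image.mp hD
      exact (e.symm j).2
    · intro hD
      obtain ⟨j, hj, hji⟩ := Finset.mem_image.mp hD
      have hji' : e.symm j = e.symm i := Subtype.ext hji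
      have : j = i := e.symm.injective hji'
      rw [Finset.mem_filter] at hj
      exact absurd hj.2 (by rw [this]; exact lt_irrefl _)
    · ext y
      simp only [Finset.coe_image, Finset.coe_filter, Finset.mem_univ, true_and, Set.mem_image,
        Set.mem_setOf_eq]
      constructor
      · rintro ⟨_, ⟨j, hj, rfl⟩, rfl⟩
        exact ⟨j, hj, rfl⟩
      · rintro ⟨j, hj, rfl⟩
        exact ⟨_, ⟨j, hj, rfl⟩, rfl⟩
  have hnzd' : ∀ i : Fin 𝒜.card,
      Ideal.Quotient.mk (Ideal.span (g '' {j : Fin 𝒜.card | (j : ℕ) < (i : ℕ)})) (g i) ∈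
        nonZeroDivisors (R ⧸ Ideal.span (g '' {j : Fin 𝒜.card | (j : ℕ) < (i : ℕ)})) := by
    intro i
    obtain ⟨T, hT𝒜, hiT, hTg⟩ := hpre i
    exact mem_nonZeroDivisors_mk_of_eq (congrArg Ideal.span hTg) (hnzd T hT𝒜 _ (e.symm i).2 hiT)
  have hrange : Set.range g = f '' (𝒜 : Set ι₀) := by
    ext y
    constructor
    · rintro ⟨k, rfl⟩
      exact ⟨_, (e.symm k).2, rfl⟩
    · rintro ⟨D, hD, rfl⟩
      exact ⟨e ⟨D, hD⟩, by simp [hg]⟩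
  haveI : IsRegularLocalRing (R ⧸ Ideal.span (Set.range g)) := by rw [hrange]; exact hreg
  exact IsRsopPart.of_forall_mem_nonZeroDivisors hgm hnzd'

/-- The same **modulo an ideal `J`** (for the divisors transversal to a centre `V(J)`): if
`R/(J + (f_D : D ∈ ℬ))` is regular and each `f_D` is a non-zero-divisor modulo `J + (f_T)`
for `T ⊆ ℬ` not containing `D`, then the images of the `f_D` in `R/J` form a part of a regular
system of parameters of `R/J`. [cite: Matsumura1987, Thm. 14.2 (Remark) and Thm. 17.4] -/
theorem isRsopPart_quotient_comp_equivFin_symm {ι₀ : Type v} [DecidableEq ι₀] (J : Ideal R)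
    (hJ : J ≠ ⊤) (ℬ : Finset ι₀) (f : ι₀ → R) (hm : ∀ D ∈ ℬ, f D ∈ maximalIdeal R)
    (hreg : IsRegularLocalRing (R ⧸ (J ⊔ Ideal.span (f '' (ℬ : Set ι₀)))))
    (hnzd : ∀ T : Finset ι₀, T ⊆ ℬ → ∀ D ∈ ℬ, D ∉ T →
      Ideal.Quotient.mk (J ⊔ Ideal.span (f '' (T : Set ι₀))) (f D) ∈
        nonZeroDivisors (R ⧸ (J ⊔ Ideal.span (f '' (T : Set ι₀))))) :
    haveI : IsLocalRing (R ⧸ J) := isLocalRing_quotient hJ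
    IsRsopPart (fun k : Fin ℬ.card => Ideal.Quotient.mk J (f (ℬ.equivFin.symm k))) := by
  haveI : IsLocalRing (R ⧸ J) := isLocalRing_quotient hJ
  haveI : IsLocalHom (Ideal.Quotient.mk J) :=
    IsLocalHom.of_surjective _ Ideal.Quotient.mk_surjective
  -- `(R/J)/(f̄_T) ≅ R/(J + (f_T))`
  let eT : ∀ T : Set ι₀,
      (R ⧸ J) ⧸ Ideal.span ((Ideal.Quotient.mk J ∘ f) '' T) ≃+* R ⧸ (J ⊔ Ideal.span (f '' T)) :=
    fun T => (Ideal.quotEquivOfEq (by rw [Ideal.map_span, Set.image_comp])).trans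
      (DoubleQuot.quotQuotEquivQuotSup J (Ideal.span (f '' T)))
  have heT : ∀ (T : Set ι₀) (a : R),
      eT T (Ideal.Quotient.mk _ (Ideal.Quotient.mk J a)) = Ideal.Quotient.mk _ a := fun T a => by
    simp only [eT, RingEquiv.trans_apply, Ideal.quotEquivOfEq_mk]
    exact DoubleQuot.quotQuotEquivQuotSup_quotQuotMk J _ a
  have h := isRsopPart_comp_equivFin_symm (R := R ⧸ J) ℬ (Ideal.Quotient.mk J ∘ f)
    (fun D hD => by
      simp only [Function.comp_apply]
      exact (map_mem_nonunits_iff (Ideal.Quotient.mk J) (f D)).mpr (hm D hD))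
    (by
      haveI := hreg
      exact IsRegularLocalRing.of_ringEquiv (eT (ℬ : Set ι₀)).symm)
    (fun T hT D hD hDT => by
      refine _root_.mem_nonZeroDivisors_of_injective (f := eT (T : Set ι₀))
        (eT (T : Set ι₀)).injective ?_
      simp only [Function.comp_apply]
      rw [heT]
      exact hnzd T hT D hD hDT)
  exact h

end Algebra

/-! ## The criterion -/

section Scheme

variable {Y : Scheme.{u}} [IsLocallyNoetherian Y]

/-- **Simple normal crossings from non-zero-divisor data** (BGMW Def. 3.1.1 / Def. 3.1.3 (2)
verified through regular sequences): let `E` be a list of ideal sheaves and `C` an ideal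
sheaf on a locally Noetherian scheme `Y`, with chosen local equations `f_x D ∈ 𝒪_{Y,x}`.
Suppose that for every point `x`:
(1) `D_x = (f_x D)` for every `D ∈ E` through `x`;
(2) for every finite set `T` of divisors of `E` through `x`, `𝒪_{Y,x}/(f_x D : D ∈ T)` is a
regular local ring, and `f_x D` is a non-zero-divisor of it for every further divisor `D`
of `E` through `x`;
(3) if `x ∈ V(C)`: for every finite set `T` of divisors of `E` through `x` whose equations do
not lie in `C_x`, `𝒪_{Y,x}/(C_x + (f_x D : D ∈ T))` is a regular local ring, and `f_x D` is a
non-zero-divisor of it for every further such divisor `D`.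
Then `HasSNCWith E C`: at `x`, the equations lying in `C_x` form a part `a` of a regular
system of parameters, the other ones a part `b` modulo `C_x`
(`isRsopPart_comp_equivFin_symm`, `isRsopPart_quotient_comp_equivFin_symm`), and
`exists_isRsopPart_append_span_eq` supplies `c ⊆ C_x` with `(a, c, b)` a part of a regular
system of parameters and `C_x = (a, c)` — the labelled data of
`hasSNCWith_of_isRsopPart_labels`.
[cite: BierstoneGrigorievMilmanWlodarczyk2011, Def. 3.1.1 and Def. 3.1.3 (2)] -/
theorem hasSNCWith_of_nonZeroDivisor_data (E : List Y.IdealSheafData) (C : Y.IdealSheafData)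
    (f : ∀ x : Y, Y.IdealSheafData → Y.presheaf.stalk x)
    (hf : ∀ x : Y, ∀ D ∈ E, x ∈ D.support → stalkIdeal D x = Ideal.span {f x D})
    (hE : ∀ (x : Y) (T : Finset Y.IdealSheafData), (∀ D ∈ T, D ∈ E ∧ x ∈ D.support) →
      IsRegularLocalRing (Y.presheaf.stalk x ⧸ Ideal.span (f x '' (T : Set Y.IdealSheafData))) ∧
      ∀ D ∈ E, x ∈ D.support → D ∉ T →
        Ideal.Quotient.mk (Ideal.span (f x '' (T : Set Y.IdealSheafData))) (f x D) ∈
          nonZeroDivisors (Y.presheaf.stalk x ⧸ Ideal.span (f x '' (T : Set Y.IdealSheafData))))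
    (hC : ∀ x ∈ C.support, ∀ (T : Finset Y.IdealSheafData),
      (∀ D ∈ T, D ∈ E ∧ x ∈ D.support ∧ f x D ∉ stalkIdeal C x) →
        IsRegularLocalRing (Y.presheaf.stalk x ⧸
          (stalkIdeal C x ⊔ Ideal.span (f x '' (T : Set Y.IdealSheafData)))) ∧
        ∀ D ∈ E, x ∈ D.support → f x D ∉ stalkIdeal C x → D ∉ T →
          Ideal.Quotient.mk (stalkIdeal C x ⊔ Ideal.span (f x '' (T : Set Y.IdealSheafData)))
            (f x D) ∈ nonZeroDivisors (Y.presheaf.stalk x ⧸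
              (stalkIdeal C x ⊔ Ideal.span (f x '' (T : Set Y.IdealSheafData))))) :
    HasSNCWith E C := by
  classical
  refine hasSNCWith_of_isRsopPart_labels E C fun x => ?_
  -- the divisors through `x`
  set 𝒟 : Finset Y.IdealSheafData := E.toFinset.filter (fun D => x ∈ D.support) with h𝒟
  have h𝒟mem : ∀ D, D ∈ 𝒟 ↔ D ∈ E ∧ x ∈ D.support := fun D => by
    simp [h𝒟, List.mem_toFinset]
  have hm : ∀ D ∈ 𝒟, f x D ∈ maximalIdeal (Y.presheaf.stalk x) := by
    intro D hD
    obtain ⟨hDE, hxD⟩ := (h𝒟mem D).mp hD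
    have h := (mem_support_iff_stalkIdeal_le D x).mp hxD
    rw [hf x D hDE hxD, Ideal.span_singleton_le_iff_mem] at h
    exact h
  by_cases hxC : x ∈ C.support
  · -- the centre passes through `x`: blocks `a` (equations in `C_x`) and `b` (the others)
    have hJtop : stalkIdeal C x ≠ ⊤ := by
      intro htop
      have h := (mem_support_iff_stalkIdeal_le C x).mp hxC
      rw [htop, top_le_iff] at h
      exact (maximalIdeal.isMaximal _).ne_top h
    -- regularity of `R/J` (the case `T = ∅` of (3))
    have hJreg : IsRegularLocalRing (Y.presheaf.stalk x ⧸ stalkIdeal C x) := by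
      have h := (hC x hxC ∅ (by simp)).1
      refine isRegularLocalRing_quotient_of_eq ?_ h
      rw [Finset.coe_empty, Set.image_empty, Ideal.span_empty, sup_bot_eq]
    set J := stalkIdeal C x with hJdef
    haveI := hJreg
    set 𝒜 : Finset Y.IdealSheafData := 𝒟.filter (fun D => f x D ∈ J) with h𝒜
    set ℬ : Finset Y.IdealSheafData := 𝒟.filter (fun D => f x D ∉ J) with hℬ
    have h𝒜𝒟 : 𝒜 ⊆ 𝒟 := Finset.filter_subset _ _
    have hℬ𝒟 : ℬ ⊆ 𝒟 := Finset.filter_subset _ _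
    -- the block `a`
    have ha : IsRsopPart (fun k : Fin 𝒜.card => f x (𝒜.equivFin.symm k)) := by
      refine isRsopPart_comp_equivFin_symm 𝒜 (f x) (fun D hD => hm D (h𝒜𝒟 hD)) ?_ ?_
      · exact (hE x 𝒜 fun D hD => (h𝒟mem D).mp (h𝒜𝒟 hD)).1
      · intro T hT D hD hDT
        obtain ⟨hDE, hxD⟩ := (h𝒟mem D).mp (h𝒜𝒟 hD)
        exact (hE x T fun D' hD' => (h𝒟mem D').mp (h𝒜𝒟 (hT hD'))).2 D hDE hxD hDT
    have haJ : ∀ k : Fin 𝒜.card, f x (𝒜.equivFin.symm k) ∈ J := fun k =>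
      (Finset.mem_filter.mp (𝒜.equivFin.symm k).2).2
    -- the block `b`
    have hℬmem : ∀ D, D ∈ ℬ → D ∈ E ∧ x ∈ D.support ∧ f x D ∉ J := fun D hD => by
      rw [hℬ, Finset.mem_filter] at hD
      exact ⟨((h𝒟mem D).mp hD.1).1, ((h𝒟mem D).mp hD.1).2, hD.2⟩
    have hb : IsRsopPart (fun k : Fin ℬ.card =>
        Ideal.Quotient.mk J (f x (ℬ.equivFin.symm k))) := by
      refine isRsopPart_quotient_comp_equivFin_symm J hJtop ℬ (f x)
        (fun D hD => hm D (hℬ𝒟 hD)) ?_ ?_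
      · exact (hC x hxC ℬ hℬmem).1
      · intro T hT D hD hDT
        obtain ⟨hDE, hxD, hDJ⟩ := hℬmem D hD
        exact (hC x hxC T fun D' hD' => hℬmem D' (hT hD')).2 D hDE hxD hDJ hDT
    obtain ⟨r, c, hcJ, hz, hspan⟩ := exists_isRsopPart_append_span_eq (J := J) ha haJ
      (fun k => hm _ (hℬ𝒟 (ℬ.equivFin.symm k).2)) hb
    -- the labels
    set a : Fin 𝒜.card → Y.presheaf.stalk x := fun k => f x (𝒜.equivFin.symm k) with hadef
    set b : Fin ℬ.card → Y.presheaf.stalk x := fun k => f x (ℬ.equivFin.symm k) with hbdef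
    set z := Fin.append (Fin.append a c) b with hzdef
    have hmem𝒜 : ∀ D : {D : Y.IdealSheafData // D ∈ E ∧ x ∈ D.support}, f x D.1 ∈ J →
        D.1 ∈ 𝒜 := fun D h => by
      rw [h𝒜, Finset.mem_filter]
      exact ⟨(h𝒟mem D.1).mpr D.2, h⟩
    have hmemℬ : ∀ D : {D : Y.IdealSheafData // D ∈ E ∧ x ∈ D.support}, f x D.1 ∉ J →
        D.1 ∈ ℬ := fun D h => by
      rw [hℬ, Finset.mem_filter]
      exact ⟨(h𝒟mem D.1).mpr D.2, h⟩
    let ι : {D : Y.IdealSheafData // D ∈ E ∧ x ∈ D.support} → Fin (𝒜.card + r + ℬ.card) :=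
      fun D => if h : f x D.1 ∈ J then
          Fin.castAdd ℬ.card (Fin.castAdd r (𝒜.equivFin ⟨D.1, hmem𝒜 D h⟩))
        else Fin.natAdd (𝒜.card + r) (ℬ.equivFin ⟨D.1, hmemℬ D h⟩)
    have hzι : ∀ D, z (ι D) = f x D.1 := by
      intro D
      by_cases h : f x D.1 ∈ J
      · simp only [ι, dif_pos h, hzdef, Fin.append_left, hadef, Equiv.symm_apply_apply]
      · simp only [ι, dif_neg h, hzdef, Fin.append_right, hbdef, Equiv.symm_apply_apply]
    refine ⟨𝒜.card + r + ℬ.card, z, hz, ⟨ι, ?_, fun D => by rw [hzι, hf x D.1 D.2.1 D.2.2]⟩, ?_⟩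
    · -- injectivity of the labels
      intro D₁ D₂ h
      have hval := congrArg Fin.val h
      by_cases h₁ : f x D₁.1 ∈ J <;> by_cases h₂ : f x D₂.1 ∈ J
      · simp only [ι, dif_pos h₁, dif_pos h₂, Fin.val_castAdd] at hval
        have h12 := 𝒜.equivFin.injective (Fin.ext hval)
        have hv := congrArg Subtype.val h12
        exact Subtype.ext hv
      · simp only [ι, dif_pos h₁, dif_neg h₂, Fin.val_castAdd, Fin.val_natAdd] at hval
        have := (𝒜.equivFin ⟨D₁.1, hmem𝒜 D₁ h₁⟩).2
        omega
      · simp only [ι, dif_neg h₁, dif_pos h₂, Fin.val_castAdd, Fin.val_natAdd] at hval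
        have := (𝒜.equivFin ⟨D₂.1, hmem𝒜 D₂ h₂⟩).2
        omega
      · simp only [ι, dif_neg h₁, dif_neg h₂, Fin.val_natAdd] at hval
        have hk : ((ℬ.equivFin ⟨D₁.1, hmemℬ D₁ h₁⟩ : Fin ℬ.card) : ℕ) =
            (ℬ.equivFin ⟨D₂.1, hmemℬ D₂ h₂⟩ : Fin ℬ.card) := by omega
        have h12 := ℬ.equivFin.injective (Fin.ext hk)
        have hv := congrArg Subtype.val h12
        exact Subtype.ext hv
    · -- `C_x = (a, c)`
      intro _
      refine ⟨{k | (k : ℕ) < 𝒜.card + r}, ?_⟩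
      rw [← hspan]
      congr 1
      ext y
      constructor
      · rintro ⟨k', rfl⟩
        refine ⟨Fin.castAdd ℬ.card k', k'.2, ?_⟩
        simp only [hzdef, Fin.append_left]
      · rintro ⟨k, hk, rfl⟩
        refine ⟨⟨k, hk⟩, ?_⟩
        rw [show z k = z (Fin.castAdd ℬ.card ⟨k, hk⟩) from congrArg z (Fin.ext rfl)]
        simp only [hzdef, Fin.append_left]
  · -- the centre does not pass through `x`: one block
    have hz : IsRsopPart (fun k : Fin 𝒟.card => f x (𝒟.equivFin.symm k)) := by
      refine isRsopPart_comp_equivFin_symm 𝒟 (f x) hm ?_ ?_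
      · exact (hE x 𝒟 fun D hD => (h𝒟mem D).mp hD).1
      · intro T hT D hD hDT
        obtain ⟨hDE, hxD⟩ := (h𝒟mem D).mp hD
        exact (hE x T fun D' hD' => (h𝒟mem D').mp (hT hD')).2 D hDE hxD hDT
    refine ⟨𝒟.card, _, hz, ⟨fun D => 𝒟.equivFin ⟨D.1, (h𝒟mem D.1).mpr D.2⟩, ?_, fun D => ?_⟩,
      fun h => absurd h hxC⟩
    · intro D₁ D₂ h
      have h12 := 𝒟.equivFin.injective h
      have hv := congrArg Subtype.val h12
      exact Subtype.ext hv
    · simp only [Equiv.symm_apply_apply]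
      exact hf x D.1 D.2.1 D.2.2

end Scheme

end Literature.AlgebraicGeometry.Resolution

end
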